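import Summits.BirchSwinnertonDyer.Rank1Residual.X11b.Three.ControlIdentityOdd
import Summits.BirchSwinnertonDyer.Rank1Residual.GaloisImage.PropagatedConditionCardEP
import Literature.NumberTheory.GaloisRepresentations.NumberFieldCdTwoProofs
import Summits.BirchSwinnertonDyer.Rank1Residual.Additive.PotSupersingularClasses
import Literature.NumberTheory.EllipticCurves.IwasawaNoFiniteSubmoduleProofs
import HarnessLib

/-!
# Route UniversalToricDescent — (N1) «no non-zero finite `Λ`-submodule of `X_ac(E[p^∞])`» at `Σ = ∅`
# from the vanishing of the `Γ`-coinvariants of Castella's Selmer group (tree atom (L10)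
# `CoinvariantsTrivialAt`), hence from the route's Poitou–Tate leaves at an additive `p`

Lead prover bsd-wall-utd-p1 g7 (`--supports stmt-BirchSwinnertonDyer-20399`; PRICING-20399-ALG-HALF §3(b),
need (N1) of child 20399 / 21845 `InvariantsTransportModThree(T)`). Greenberg–Vatsal's λ-transport
(landed for the route as `UniversalToricDescentLambdaTransport.lambdaInvariant_baseChange_eq_of_modPCongruent`)
carries the hypothesis that the Pontryagin dual `X = X_ac^Σ(E[p^∞])` (`AcSelmer.XAc`) has no non-zero
FINITE `Λ`-submodule. This file discharges it at `Σ = ∅` from an input the tree already PROVES modulo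
cited cohomological facts:

* §1 (any number field `K`, any `ℤ_p`-extension, any `Σ`, pure algebra on the dual pair):
  `XAc.invariants_eq_bot_of_surjective` — if `conj_γ − 1` is ONTO `Sel_𝔭^Σ(K_∞, E[p^∞])` then
  `X_ac^Σ[T] = 0` (`T` acts on a character `x` as `x ∘ (conj_γ − 1)`, `XAc.X_smul_apply`);
  `XAc.forall_finite_eq_bot_of_surjective` — hence `X_ac^Σ` has no non-zero finite `Λ`-submodule
  (Kitajima–Otsuki Lemma 3.30 (2) / NSW 5.3.19 (ii) ⟸-direction, tree
  `IwasawaAlgebra.forall_finite_eq_bot_of_forall_pow_smul_invariants_eq_zero`: a finite submodule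
  `N ≠ 0` meets `X[T]`).
* §2 `forall_finite_eq_bot_of_coinvariantsTrivialAt` — the `Σ = ∅` reading on the tree's named atom
  (L10) `X11b.CoinvariantsTrivialAt E p κ 𝔭 γ` (JSW17 Lemma 3.3.3 shape).
* §3 `forall_finite_eq_bot_baseChange_of_noPTorsionPadic` — for `W/ℚ`, `K` imaginary quadratic with
  `p` split, a degree-one `𝔭 ∋ p` as the STRICT place, ANY `ℤ_p`-extension `κ` with topological
  generator `γ`, (iv) `E(ℚ_p)[p] = 0` and `Sel_v(K, E[p^∞])` finite at both `v ∣ p`: (N1) for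
  `X_ac^∅(E_K)`, GIVEN the cited facts Poitou–Tate ×2 (the route's open leaves 20461 / 20462) — the
  tree's `X11b.coinvariantsTrivialAt_of_noPTorsion` (Milne I 2.8 and `cd_p ≤ 2` are tree theorems:
  `EP.localEulerPoincareCharacteristic_adicCompletion`, `fieldCdLE_two_of_numberField_holds`).
* §4 `forall_finite_eq_bot_baseChange_three_of_heegner` — the `p = 3` reading in the crux's binders
  (`3` splits in the Heegner field because `3 ∣ N`).

HONEST STATUS: helper theorems (N1 at `Σ = ∅` only; the `Σ`-imprimitive (N1), the base finiteness
`Sel_v(K, E[p^∞]) < ∞` — on the route available from the K1 door at a rank-one datum,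
`SchneiderFreeAdditiveX3.additiveBaseSelmerCountAt_of_facts` — and the analytic half of 21845 are
NOT touched). THEOREMS ONLY; no definition, no new named fact, no `sorry`; §3–§4 are CONDITIONAL on
the two cited Poitou–Tate facts. BSD is not advanced by this file.
References: [GreenbergLNM1716] Prop. 4.14–4.15 (pp. 124–126), §1 p. 60; [KitajimaOtsuki2018]
Lemma 3.30 (2); [NeukirchSchmidtWingberg2008] Prop. 5.3.19 (ii); [JetchevSkinnerWan2017] Lemma 3.3.3
(arXiv:1512.06894 pp. 11–12); [Castella2018Erratum] Lemma 2.1 / Thm. 1.1; [MilneADT2006] I 2.8, 4.10.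
-/

set_option autoImplicit false
-- `…BirchSwinnertonDyer.BirchSwinnertonDyer.Theorems…` is the problem's mandated namespace (D-0017).
set_option linter.dupNamespace false

noncomputable section

open scoped Classical

namespace Summit.BirchSwinnertonDyer.BirchSwinnertonDyer.Theorems.UniversalToricDescentNoFiniteSubmodule

open NumberField IsDedekindDomain Field WeierstrassCurve
open Literature.NumberTheory.EllipticCurves Literature.NumberTheory.EllipticCurves.IwasawaAlgebra
  Literature.NumberTheory.EllipticCurves.GreenbergSelmer
  Literature.NumberTheory.GaloisRepresentations Literature.NumberTheory.GaloisCohomology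
  Literature.NumberTheory.EllipticCurves.Rank1Residual
  Summit.BirchSwinnertonDyer.Rank1Residual Summit.BirchSwinnertonDyer.Rank1Residual.X11b
  Summit.BirchSwinnertonDyer.Rank1Residual.X11b.AcSelmer

universe u

/-! ### §1 `conj_γ − 1` onto `Sel` ⟹ `X[T] = 0` ⟹ no non-zero finite `Λ`-submodule (any `K`, `κ`, `Σ`) -/

section Generic

variable {K : Type u} [Field K] [NumberField K] (W : WeierstrassCurve K) (p : ℕ) [Fact p.Prime]
  (κ : ZpExtension K p) (𝔭 : HeightOneSpectrum (𝓞 K)) (S : Set (HeightOneSpectrum (𝓞 K)))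
  (γ : absoluteGaloisGroup K) [Fact (κ.IsTopGenerator γ)]

/-- **`(conj_γ − 1)` onto `Sel_𝔭^Σ(K_∞, E[p^∞])` ⟹ `X_ac^Σ(E[p^∞])[T] = 0`.** A character `x` of `Sel`
with `T·x = 0` satisfies `x(conj_γ s) = x(s)` for all `s` (`XAc.X_smul_apply`), i.e. `x` kills the
range of `conj_γ − 1`, which is everything. (Pontryagin: `X[T] = Hom(Sel_Γ, ℚ/ℤ)`.)
[cite: GreenbergLNM1716, §1 p. 60 (after Conj. 1.3)] -/
theorem XAc.invariants_eq_bot_of_surjective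
    (hsurj : Function.Surjective
      ((conjSelmerAc W p κ 𝔭 S γ - 1 : AddMonoid.End (selmerAc W p κ 𝔭 S)) :
        selmerAc W p κ 𝔭 S → selmerAc W p κ 𝔭 S)) :
    invariants p (XAc W p κ 𝔭 S γ) = ⊥ := by
  rw [eq_bot_iff]
  intro x hx
  rw [Submodule.mem_bot]
  rw [mem_invariants_iff] at hx
  apply DFunLike.ext
  intro s
  obtain ⟨t, rfl⟩ := hsurj s
  have h := DFunLike.congr_fun hx t
  rw [XAc.X_smul_apply] at h
  -- `h : x (conj t) - x t = 0`
  rw [IwasawaDual.End_sub_apply, AddMonoid.End.one_apply, map_sub]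
  rw [h]
  rfl

/-- **`(conj_γ − 1)` onto `Sel_𝔭^Σ(K_∞, E[p^∞])` ⟹ `X_ac^Σ(E[p^∞])` has no non-zero finite
`Λ`-submodule** (a finite `Λ`-submodule `N ≠ 0` contains a non-zero element of `X[T]`, Kitajima–Otsuki
Lemma 3.30 (2) ⟸; here `X[T] = 0`). This is the dual form of "`Sel` has no proper `Λ`-submodule of
finite index" used by Greenberg (LNM 1716 Prop. 4.14/4.15) and Greenberg–Vatsal (Prop. 2.1).
[cite: KitajimaOtsuki2018, Lemma 3.30 (2)] [cite: NeukirchSchmidtWingberg2008, Prop. 5.3.19 (ii)]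
[cite: GreenbergLNM1716, Prop. 4.14 (p. 124)] -/
theorem XAc.forall_finite_eq_bot_of_surjective
    (hsurj : Function.Surjective
      ((conjSelmerAc W p κ 𝔭 S γ - 1 : AddMonoid.End (selmerAc W p κ 𝔭 S)) :
        selmerAc W p κ 𝔭 S → selmerAc W p κ 𝔭 S)) :
    ∀ N : Submodule (IwasawaAlgebra p) (XAc W p κ 𝔭 S γ), Finite N → N = ⊥ := by
  refine forall_finite_eq_bot_of_forall_pow_smul_invariants_eq_zero p fun x hx k _ ↦ ?_
  rw [XAc.invariants_eq_bot_of_surjective W p κ 𝔭 S γ hsurj, Submodule.mem_bot] at hx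
  exact hx

end Generic

/-! ### §2 `Σ = ∅`: the tree's atom (L10) `CoinvariantsTrivialAt` -/

section Atom

variable {K : Type} [Field K] [NumberField K] (W : WeierstrassCurve K) (p : ℕ) [Fact p.Prime]
  (κ : ZpExtension K p) (𝔭 : HeightOneSpectrum (𝓞 K))
  (γ : absoluteGaloisGroup K) [Fact (κ.IsTopGenerator γ)]

/-- **(L10) ⟹ (N1) at `Σ = ∅`.** If `CoinvariantsTrivialAt E p κ 𝔭 γ` (the `Γ`-coinvariants of
`Sel_𝔭(K_∞, E[p^∞])` vanish, JSW17 Lemma 3.3.3 shape) then `X_ac(E[p^∞]) = X_ac^∅` has no non-zero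
finite `Λ`-submodule. [cite: JetchevSkinnerWan2017, Lemma 3.3.3 (arXiv:1512.06894 pp. 11–12)]
[cite: GreenbergLNM1716, Prop. 4.14 (p. 124)] -/
theorem forall_finite_eq_bot_of_coinvariantsTrivialAt (h : CoinvariantsTrivialAt W p κ 𝔭 γ) :
    ∀ N : Submodule (IwasawaAlgebra p) (XAc W p κ 𝔭 ∅ γ), Finite N → N = ⊥ :=
  XAc.forall_finite_eq_bot_of_surjective W p κ 𝔭 ∅ γ h

/-- **(L10) ⟹ `X_ac(E[p^∞])[T] = 0`** (`Σ = ∅`). [cite: GreenbergLNM1716, §1 p. 60] -/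
theorem invariants_eq_bot_of_coinvariantsTrivialAt (h : CoinvariantsTrivialAt W p κ 𝔭 γ) :
    invariants p (XAc W p κ 𝔭 ∅ γ) = ⊥ :=
  XAc.invariants_eq_bot_of_surjective W p κ 𝔭 ∅ γ h

end Atom

/-! ### §3 `W/ℚ`, `K` imaginary quadratic with `p` split, (iv): (N1) from the cited Poitou–Tate facts -/

section Route

variable (W : WeierstrassCurve ℚ) [W.IsElliptic] [W.IsGloballyMinimal] (p : ℕ) [Fact p.Prime]
  {K : Type} [Field K] [NumberField K]

/-- **(N1) for `X_ac^∅(E_K)` at a degree-one strict place, from (iv) and the cited facts.** For `W/ℚ`,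
`K` imaginary quadratic with `p` split, a `ℤ_p`-extension `κ` of `K` with topological generator `γ`,
a degree-one prime `𝔭 ∋ p` (the STRICT place of `Sel_𝔭`), (iv) `E(ℚ_p)[p] = 0`, and
`Sel_v(K, E[p^∞])` finite for every `v ∣ p`: `X_ac^∅(E_K[p^∞])` (strict at `𝔭`) has no non-zero finite
`Λ`-submodule — GIVEN the cited Poitou–Tate duality for Selmer structures and for `Ш` over `K`
(Milne I 4.10; the route's leaves 20461/20462). Chain: (iv) + facts ⟹ (L10) `CoinvariantsTrivialAt`
(`X11b.coinvariantsTrivialAt_of_noPTorsion`, with Milne I 2.8 and `cd_p(Γ_K) ≤ 2` supplied by the tree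
theorems `EP.localEulerPoincareCharacteristic_adicCompletion`, `fieldCdLE_two_of_numberField_holds`)
⟹ `X[T] = 0` ⟹ (N1) (§1). CONDITIONAL (named-fact hypotheses).
[cite: JetchevSkinnerWan2017, Lemma 3.3.3 (arXiv:1512.06894 pp. 11–12)]
[cite: MilneADT2006, Ch. I, Thm. 4.10] [cite: GreenbergLNM1716, Prop. 4.14–4.15 (pp. 124–126)] -/
theorem forall_finite_eq_bot_baseChange_of_noPTorsionPadic
    (h4 : ∀ R : (W.baseChange ℚ_[p]).toAffine.Point, p • R = 0 → R = 0)
    (hPT : poitouTate_selmerStructure_duality K) (hPT2 : poitouTate_sha_tateDual K)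
    (hK : IsImaginaryQuadratic K) (hsplit : SplitsIn K p)
    (κ : ZpExtension K p) (γ : absoluteGaloisGroup K) [hγ : Fact (κ.IsTopGenerator γ)]
    {𝔭 : HeightOneSpectrum (𝓞 K)} (h𝔭 : ((p : ℕ) : 𝓞 K) ∈ 𝔭.asIdeal)
    (he : 𝔭.asIdeal.ramificationIdx (𝓞 ℚ) = 1) (hf : 𝔭.asIdeal.inertiaDeg (𝓞 ℚ) = 1)
    (hfin : ∀ v : HeightOneSpectrum (𝓞 K), ((p : ℕ) : 𝓞 K) ∈ v.asIdeal →
      Finite (selmerAcBase (W.baseChange K) p v ∅)) :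
    ∀ N : Submodule (IwasawaAlgebra p) (XAc (W.baseChange K) p κ 𝔭 ∅ γ), Finite N → N = ⊥ :=
  forall_finite_eq_bot_of_coinvariantsTrivialAt (W.baseChange K) p κ 𝔭 γ
    (coinvariantsTrivialAt_of_noPTorsion W p h4 hPT hPT2
      (fun v ↦ GaloisImage.EP.localEulerPoincareCharacteristic_adicCompletion K v)
      fieldCdLE_two_of_numberField_holds hK hsplit κ hγ.out h𝔭 he hf hfin)

/-- **`X_ac^∅(E_K)[T] = 0` under the same hypotheses** (the `Γ`-invariants of the dual vanish; with
Greenberg's Lemma 4.2 this is the clause "`#ℤ_p/f_ac(0) = #X_Γ`" of the control count).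
[cite: JetchevSkinnerWan2017, Lemma 3.3.3 (arXiv:1512.06894 pp. 11–12)] [cite: GreenbergLNM1716, Lemma 4.2 (p. 102)] -/
theorem invariants_eq_bot_baseChange_of_noPTorsionPadic
    (h4 : ∀ R : (W.baseChange ℚ_[p]).toAffine.Point, p • R = 0 → R = 0)
    (hPT : poitouTate_selmerStructure_duality K) (hPT2 : poitouTate_sha_tateDual K)
    (hK : IsImaginaryQuadratic K) (hsplit : SplitsIn K p)
    (κ : ZpExtension K p) (γ : absoluteGaloisGroup K) [hγ : Fact (κ.IsTopGenerator γ)]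
    {𝔭 : HeightOneSpectrum (𝓞 K)} (h𝔭 : ((p : ℕ) : 𝓞 K) ∈ 𝔭.asIdeal)
    (he : 𝔭.asIdeal.ramificationIdx (𝓞 ℚ) = 1) (hf : 𝔭.asIdeal.inertiaDeg (𝓞 ℚ) = 1)
    (hfin : ∀ v : HeightOneSpectrum (𝓞 K), ((p : ℕ) : 𝓞 K) ∈ v.asIdeal →
      Finite (selmerAcBase (W.baseChange K) p v ∅)) :
    invariants p (XAc (W.baseChange K) p κ 𝔭 ∅ γ) = ⊥ :=
  invariants_eq_bot_of_coinvariantsTrivialAt (W.baseChange K) p κ 𝔭 γ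
    (coinvariantsTrivialAt_of_noPTorsion W p h4 hPT hPT2
      (fun v ↦ GaloisImage.EP.localEulerPoincareCharacteristic_adicCompletion K v)
      fieldCdLE_two_of_numberField_holds hK hsplit κ hγ.out h𝔭 he hf hfin)

end Route

/-! ### §4 The crux's binders (`p = 3`, Heegner field, wild conductor): `3` splits in `K` for free -/

section Three

variable (W : WeierstrassCurve ℚ) [W.IsElliptic] [W.IsGloballyMinimal] {K : Type} [Field K]
  [NumberField K]

/-- **(N1) at `Σ = ∅` in the binders of crux #2 / 21845** (`p = 3`): `E/ℚ` wild at `3`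
(`ClassO6 W 3`, so `3 ∣ N`), `N = N(E)`, `K` imaginary quadratic with the Heegner hypothesis for `N`
(hence `3` splits in `K`: `SatisfiesHeegnerHypothesis` at `3 ∣ N`), ANY `ℤ₃`-extension `κ` with topological generator `γ`, a degree-one
`𝔭 ∋ 3` as the strict place, (iv) `E(ℚ₃)[3] = 0` (1 817 of the 2 023 habitat classes, census Q-T3),
`Sel_v(K, E[3^∞])` finite at both `v ∣ 3`: `X_ac^∅(E_K[3^∞])` strict at `𝔭` has no non-zero finite
`Λ`-submodule, GIVEN Poitou–Tate ×2. Instantiate at `𝔭 := 𝔭′` (the crux's strict place, which is of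
degree one as the conjugate of the degree-one `𝔭`). CONDITIONAL (named-fact hypotheses).
[cite: JetchevSkinnerWan2017, Lemma 3.3.3 (arXiv:1512.06894 pp. 11–12)] [cite: MilneADT2006, Ch. I, Thm. 4.10]
[cite: GreenbergLNM1716, Prop. 4.14–4.15 (pp. 124–126)] -/
theorem forall_finite_eq_bot_baseChange_three_of_heegner {N : ℕ}
    (hO6 : Additive.ClassO6 W 3) (hN : W.conductorNorm ℤ = N) (hK : IsImaginaryQuadratic K)
    (hHe : SatisfiesHeegnerHypothesis N K)
    (h4 : ∀ R : (W.baseChange ℚ_[3]).toAffine.Point, 3 • R = 0 → R = 0)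
    (hPT : poitouTate_selmerStructure_duality K) (hPT2 : poitouTate_sha_tateDual K)
    (κ : ZpExtension K 3) (γ : absoluteGaloisGroup K) [Fact (κ.IsTopGenerator γ)]
    {𝔭 : HeightOneSpectrum (𝓞 K)} (h𝔭 : ((3 : ℕ) : 𝓞 K) ∈ 𝔭.asIdeal)
    (he : 𝔭.asIdeal.ramificationIdx (𝓞 ℚ) = 1) (hf : 𝔭.asIdeal.inertiaDeg (𝓞 ℚ) = 1)
    (hfin : ∀ v : HeightOneSpectrum (𝓞 K), ((3 : ℕ) : 𝓞 K) ∈ v.asIdeal →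
      Finite (selmerAcBase (W.baseChange K) 3 v ∅)) :
    ∀ N : Submodule (IwasawaAlgebra 3) (XAc (W.baseChange K) 3 κ 𝔭 ∅ γ), Finite N → N = ⊥ := by
  have hadd : Addv W 3 := hO6.2.1
  have hpN : 3 ∣ W.conductorNorm ℤ :=
    (W.dvd_conductorNorm_iff_not_hasGoodReductionAtPrime 3).mpr hadd.1
  have hsplit : SplitsIn K 3 := hHe 3 (Fact.out) (hN ▸ hpN)
  exact forall_finite_eq_bot_baseChange_of_noPTorsionPadic W 3 h4 hPT hPT2 hK hsplit κ γ h𝔭 he hf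
    hfin

end Three

end Summit.BirchSwinnertonDyer.BirchSwinnertonDyer.Theorems.UniversalToricDescentNoFiniteSubmodule

end
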